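import Summits.MatrixMultiplication.MatrixMultiplication.Theorems.LevelGradedCohnUmansLevelOneGL2DesignsTangencyPlaneUnital
import Summits.MatrixMultiplication.MatrixMultiplication.Theorems.LevelGradedCohnUmansLevelOneGL2DesignsStubTangencySetsUnitalBound

/-!
# Integrality refinements of the Illés–Szőnyi–Wettl count in an abstract projective plane — stub
`stub_tangencySets` (crux `LevelOneGL2Designs`, stmt-MatrixMultiplication-14080), wall-breaker axis 10/12
"Hermitian unital constructions", generation 1 (seat 3), part 3

Parts 1–2 (`…TangencyPlaneUnital`, `…Converse`): for a strong representative system `S` (flags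
`(pᵢ, ℓᵢ)`, `pᵢ ∈ ℓⱼ ↔ i = j`) of a plane of order `n`, `N = |S|`, the secant degrees `k_ℓ` of the
`n² + n + 1 − N` non-designated lines have `Σ k_ℓ = N n`, `Σ k_ℓ² = N(N−1) + N n`; the Cauchy–Schwarz
slack is `N(n³ − (N−1)²)` and vanishes exactly at the unitals (`n` square).  Over a NON-square order the
mean secant degree `≈ √n + 1` is not an integer while every `k_ℓ` is, and this file cashes that in:

* `srs_integrality` — for every `a : ℕ`, `2a·N·n ≤ N(N−1) + a(a+1)(n² + n + 1 − N)` (sum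
  `(k_ℓ − a)(k_ℓ − a − 1) ≥ 0`); `srs_integrality_eq` — equality forces every secant degree into
  `{a, a+1}` (a semioval "of type `(1, a, a+1)`");
* `srs_card_le_of_order_eq_eleven | thirteen | seventeen | nineteen | twentythree | twentynine | thirtyone`
  — in ANY projective plane of order `11, 13, 17, 19, 23, 29, 31` a strong representative system has at
  most `36, 46, 70, 82, 109, 155, 170` flags (ISW: `37, 47, 71, 83, 111, 157, 173`).  In particular
  the siege plan's question "is `SRS(11) = 37`?" (DECOMPOSITIONS.md §2, census `SRS(11) ≥ 35`) has the
  answer no.  (The affine caps of axis k7,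
  `UnitalBound…Exact.stub_tangencyAt_11_not_36` etc.: `T(p) ≤ 35, 45, 69, 81, 108` in the stub's own
  format, are one lower: there the extra normalisation "no tangent through the origin" enters the count;
  via `T(p) ≤ SRS(p)` the projective caps give affine ones one unit weaker, while the affine caps say
  nothing about projective systems — the present statements are new);
* `srs_type_of_order_eq_three | five | seven` — at the orders `3, 5, 7`, where the census maxima
  `SRS = 6, 12, 19` EQUAL the ISW value, integrality is tight and an extremal system is forced to be of
  type `(1,2,3)`, `(1,3,4)`, `(1,3,4)` respectively — for `q = 7` this is the type of the cyclic
  (Singer-orbit) semioval of `PG(2,7)` of size `19` (Kiss 2008, p. 20), the one prime order at which the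
  "unital substitute" is extremal on the nose.

Reading for the stub: integrality moves the additive constant only (`O(n·‖√n‖²)` below ISW), never the
exponent; it is recorded because it is the complete elementary content of the moment method in prime
order, and because its tight cases `3, 5, 7` and first slack case `11` delimit exactly where the census
of the wall stops being classical.  Sources: Illés–Szőnyi–Wettl 1991 (Zbl 0741.51013); Blokhuis–Metsch,
*Large minimal blocking sets, strong representative systems, and partial unitals*, LMS Lecture Notes 191
(1993) 37–52, Lemma 3.1 (the moments, in an arbitrary projective plane) and Thm 3.2 (deficiency `d ≥ 0`,
`= 0` iff unital — part 1's `srs_extremal_structure`); Kiss, *A survey on semiovals* (2008).  Elementary;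
imports part 1 and `…StubTangencySetsUnitalBound` (for the one-line integer
inequality); no definitions.
-/

-- `Summit.MatrixMultiplication.MatrixMultiplication.…` is the tree's mandated summit/problem namespace (D-0017).
set_option linter.dupNamespace false

namespace Summit.MatrixMultiplication.MatrixMultiplication.Theorems.LevelOneGL2Designs.PlaneUnital

open Finset Configuration
open Summit.MatrixMultiplication.MatrixMultiplication.Theorems.LevelOneGL2Designs.PlaneSRS
  (srs_card_sub_one_sq_le)
open Summit.MatrixMultiplication.MatrixMultiplication.Theorems.LevelOneGL2Designs.UnitalBound
  (two_mul_add_one_mul_le_sq_add)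

variable {P L : Type*} [Membership P L] [Configuration.ProjectivePlane P L] [Fintype P] [Fintype L]

/-! ## Integrality of the secant degrees -/

/-- `(2a + 1)k = k² + a(a + 1)` holds for naturals iff `k = a` or `k = a + 1` (the inequality `≤`,
`(k − a)(k − a − 1) ≥ 0`, is `UnitalBound.two_mul_add_one_mul_le_sq_add` of axis k7). [elementary] -/
theorem two_mul_add_one_mul_eq_iff (k a : ℕ) :
    (2 * a + 1) * k = k ^ 2 + a * (a + 1) ↔ k = a ∨ k = a + 1 := by
  constructor
  · intro h
    have h' : ((k : ℤ) - a) * ((k : ℤ) - a - 1) = 0 := by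
      have hc := congrArg (Nat.cast : ℕ → ℤ) h
      push_cast at hc
      linear_combination -hc
    rcases mul_eq_zero.mp h' with h1 | h1
    · left
      exact_mod_cast (sub_eq_zero.mp h1)
    · right
      have : (k : ℤ) = a + 1 := by linarith
      exact_mod_cast this
  · rintro (rfl | rfl) <;> ring

open scoped Classical in
/-- **Integrality refinement of the Illés–Szőnyi–Wettl count.**  For a strong representative system
`S` of a projective plane of order `n`, `N = |S|`, and EVERY natural number `a`:
`2a·N·n ≤ N(N − 1) + a(a + 1)(n² + n + 1 − N)`.
(Sum `(2a+1)k_ℓ ≤ k_ℓ² + a(a+1)` over the `n² + n + 1 − N` non-designated lines and insert the moments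
`Σ k_ℓ = N n`, `Σ k_ℓ² = N(N−1) + N n` of `srs_moments`.)  Optimising `a ∈ ℝ` returns ISW; the point
is that `a` must be an integer while the mean secant degree `N n/(n² + n + 1 − N) ≈ √n + 1` need not be
— in non-square order this beats ISW by one or two (below). [elementary; cf. the affine count
`UnitalBound.srs_count_ineq` of axis k7] -/
theorem srs_integrality (S : Finset (P × L)) (hS : ∀ f ∈ S, ∀ g ∈ S, (f.1 ∈ g.2 ↔ f = g)) (a : ℕ) :
    2 * a * (S.card * ProjectivePlane.order P L) ≤
      S.card * (S.card - 1) + a * (a + 1) * (ProjectivePlane.order P L ^ 2 + ProjectivePlane.order P L + 1 - S.card) := by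
  obtain ⟨-, hsum, hsq, hcard⟩ := srs_moments S hS
  set n : ℕ := ProjectivePlane.order P L with hn_def
  set N : ℕ := S.card with hN_def
  set L' : Finset L := univ \ S.image Prod.snd with hL'_def
  have hM : n ^ 2 + n + 1 - N = L'.card := by omega
  have hterm : ∀ ℓ ∈ L', (2 * a + 1) * (S.filter fun f => f.1 ∈ ℓ).card ≤
      (S.filter fun f => f.1 ∈ ℓ).card ^ 2 + a * (a + 1) := fun ℓ _ => two_mul_add_one_mul_le_sq_add _ a
  have hle := Finset.sum_le_sum hterm
  rw [← Finset.mul_sum, Finset.sum_add_distrib, Finset.sum_const, smul_eq_mul, hsum, hsq] at hle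
  rw [hM]
  nlinarith [hle]

open scoped Classical in
/-- **Equality in the integrality refinement forces two secant degrees.**  If
`2a·N·n = N(N − 1) + a(a + 1)(n² + n + 1 − N)` then every non-designated line meets the point set of
`S` in `a` or `a + 1` points (a "semioval of type `(1, a, a+1)`"); for `a = r`, `n = r²` this contains
the unital case of `srs_extremal_structure`. [elementary] -/
theorem srs_integrality_eq (S : Finset (P × L)) (hS : ∀ f ∈ S, ∀ g ∈ S, (f.1 ∈ g.2 ↔ f = g)) (a : ℕ)
    (heq : 2 * a * (S.card * ProjectivePlane.order P L) =
      S.card * (S.card - 1) + a * (a + 1) * (ProjectivePlane.order P L ^ 2 + ProjectivePlane.order P L + 1 - S.card)) :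
    ∀ ℓ : L, ℓ ∉ S.image Prod.snd →
      (S.filter fun f => f.1 ∈ ℓ).card = a ∨ (S.filter fun f => f.1 ∈ ℓ).card = a + 1 := by
  obtain ⟨-, hsum, hsq, hcard⟩ := srs_moments S hS
  set n : ℕ := ProjectivePlane.order P L with hn_def
  set N : ℕ := S.card with hN_def
  set L' : Finset L := univ \ S.image Prod.snd with hL'_def
  set k : L → ℕ := fun ℓ => (S.filter fun f => f.1 ∈ ℓ).card with hk_def
  have hM : n ^ 2 + n + 1 - N = L'.card := by omega
  -- the slacks `k² + a(a+1) − (2a+1)k` are non-negative and sum to zero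
  set s : L → ℕ := fun ℓ => k ℓ ^ 2 + a * (a + 1) - (2 * a + 1) * k ℓ with hs_def
  have hs : ∀ ℓ, s ℓ + (2 * a + 1) * k ℓ = k ℓ ^ 2 + a * (a + 1) := fun ℓ =>
    Nat.sub_add_cancel (two_mul_add_one_mul_le_sq_add (k ℓ) a)
  have hsum_s : ∑ ℓ ∈ L', s ℓ + (2 * a + 1) * ∑ ℓ ∈ L', k ℓ = ∑ ℓ ∈ L', k ℓ ^ 2 + a * (a + 1) * L'.card := by
    rw [Finset.mul_sum, ← Finset.sum_add_distrib, Finset.sum_congr rfl fun ℓ _ => hs ℓ,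
      Finset.sum_add_distrib, Finset.sum_const, smul_eq_mul, mul_comm]
  have hsumk : ∑ ℓ ∈ L', k ℓ = N * n := hsum
  have hsumk2 : ∑ ℓ ∈ L', k ℓ ^ 2 = N * (N - 1) + N * n := hsq
  rw [hsumk, hsumk2, ← hM] at hsum_s
  have hzero : ∑ ℓ ∈ L', s ℓ = 0 := by nlinarith [hsum_s, heq]
  intro ℓ hℓ
  have hℓ' : ℓ ∈ L' := by
    rw [hL'_def, Finset.mem_sdiff]
    exact ⟨Finset.mem_univ _, hℓ⟩
  have hsℓ : s ℓ = 0 := Finset.sum_eq_zero_iff.mp hzero ℓ hℓ'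
  have hkℓ : (2 * a + 1) * k ℓ = k ℓ ^ 2 + a * (a + 1) := by
    have := hs ℓ
    rw [hsℓ, zero_add] at this
    exact this
  exact (two_mul_add_one_mul_eq_iff (k ℓ) a).mp hkℓ

/-! ## Small non-square orders: one or two below ISW, and the forced types at `3, 5, 7` -/

/-- From `(N − 1)² ≤ B < K²` conclude `N ≤ K`. [elementary] -/
theorem le_of_sub_one_sq_le {N B K : ℕ} (h : (N - 1) ^ 2 ≤ B) (hK : B < K ^ 2) : N ≤ K := by
  by_contra hlt
  push Not at hlt
  have h1 : K ≤ N - 1 := by omega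
  have h2 : K ^ 2 ≤ (N - 1) ^ 2 := Nat.pow_le_pow_left h1 2
  omega

/-- **Order 11: `|S| ≤ 36`** (ISW alone gives `37`; the census question "is `SRS(11) = 37`?" of the
siege plan is answered in the negative for EVERY projective plane of order `11`).  Integrality with
`a = 4` at `N = 37`: `2·4·37·11 = 3256 > 37·36 + 20·96 = 3252`. [elementary] -/
theorem srs_card_le_of_order_eq_eleven (h11 : ProjectivePlane.order P L = 11) (S : Finset (P × L))
    (hS : ∀ f ∈ S, ∀ g ∈ S, (f.1 ∈ g.2 ↔ f = g)) : S.card ≤ 36 := by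
  have hisw := srs_card_sub_one_sq_le S hS
  have hint := srs_integrality S hS 4
  rw [h11] at hisw hint
  have h37 : S.card ≤ 37 := le_of_sub_one_sq_le hisw (by norm_num)
  by_contra hlt
  have h : S.card = 37 := by omega
  rw [h] at hint
  norm_num at hint

/-- **Order 13: `|S| ≤ 46`** (ISW: `47`).  Integrality with `a = 4` at `N = 47`:
`2·4·47·13 = 4888 > 47·46 + 20·136 = 4882`. [elementary] -/
theorem srs_card_le_of_order_eq_thirteen (h13 : ProjectivePlane.order P L = 13) (S : Finset (P × L))
    (hS : ∀ f ∈ S, ∀ g ∈ S, (f.1 ∈ g.2 ↔ f = g)) : S.card ≤ 46 := by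
  have hisw := srs_card_sub_one_sq_le S hS
  have hint := srs_integrality S hS 4
  rw [h13] at hisw hint
  have h47 : S.card ≤ 47 := le_of_sub_one_sq_le hisw (by norm_num)
  by_contra hlt
  have h : S.card = 47 := by omega
  rw [h] at hint
  norm_num at hint

/-- **Order 17: `|S| ≤ 70`** (ISW: `71`).  Integrality with `a = 5` at `N = 71`:
`2·5·71·17 = 12070 > 71·70 + 30·236 = 12050`. [elementary] -/
theorem srs_card_le_of_order_eq_seventeen (h17 : ProjectivePlane.order P L = 17) (S : Finset (P × L))
    (hS : ∀ f ∈ S, ∀ g ∈ S, (f.1 ∈ g.2 ↔ f = g)) : S.card ≤ 70 := by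
  have hisw := srs_card_sub_one_sq_le S hS
  have hint := srs_integrality S hS 5
  rw [h17] at hisw hint
  have h71 : S.card ≤ 71 := le_of_sub_one_sq_le hisw (by norm_num)
  by_contra hlt
  have h : S.card = 71 := by omega
  rw [h] at hint
  norm_num at hint

/-- **Order 19: `|S| ≤ 82`** (ISW: `83`).  Integrality with `a = 5` at `N = 83`:
`2·5·83·19 = 15770 > 83·82 + 30·298 = 15746`. [elementary] -/
theorem srs_card_le_of_order_eq_nineteen (h19 : ProjectivePlane.order P L = 19) (S : Finset (P × L))
    (hS : ∀ f ∈ S, ∀ g ∈ S, (f.1 ∈ g.2 ↔ f = g)) : S.card ≤ 82 := by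
  have hisw := srs_card_sub_one_sq_le S hS
  have hint := srs_integrality S hS 5
  rw [h19] at hisw hint
  have h83 : S.card ≤ 83 := le_of_sub_one_sq_le hisw (by norm_num)
  by_contra hlt
  have h : S.card = 83 := by omega
  rw [h] at hint
  norm_num at hint

/-- **Order 23: `|S| ≤ 109`** (ISW: `111`; two values excluded).  Integrality with `a = 5`:
at `N = 111`, `25530 > 12210 + 13260`; at `N = 110`, `25300 > 11990 + 13290`. [elementary] -/
theorem srs_card_le_of_order_eq_twentythree (h23 : ProjectivePlane.order P L = 23) (S : Finset (P × L))
    (hS : ∀ f ∈ S, ∀ g ∈ S, (f.1 ∈ g.2 ↔ f = g)) : S.card ≤ 109 := by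
  have hisw := srs_card_sub_one_sq_le S hS
  have hint := srs_integrality S hS 5
  rw [h23] at hisw hint
  have h111 : S.card ≤ 111 := le_of_sub_one_sq_le hisw (by norm_num)
  by_contra hlt
  have h : S.card = 110 ∨ S.card = 111 := by omega
  rcases h with h | h <;> rw [h] at hint <;> norm_num at hint

/-- **Order 29: `|S| ≤ 155`** (ISW: `157`; two values excluded by integrality with `a = 6`:
`54636 > 54480` at `N = 157`, `54288 > 54210` at `N = 156`; `N = 155` survives by `2`). [elementary] -/
theorem srs_card_le_of_order_eq_twentynine (h29 : ProjectivePlane.order P L = 29) (S : Finset (P × L))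
    (hS : ∀ f ∈ S, ∀ g ∈ S, (f.1 ∈ g.2 ↔ f = g)) : S.card ≤ 155 := by
  have hisw := srs_card_sub_one_sq_le S hS
  have hint := srs_integrality S hS 6
  rw [h29] at hisw hint
  have h157 : S.card ≤ 157 := le_of_sub_one_sq_le hisw (by norm_num)
  by_contra hlt
  have h : S.card = 156 ∨ S.card = 157 := by omega
  rcases h with h | h <;> rw [h] at hint <;> norm_num at hint

/-- **Order 31: `|S| ≤ 170`** (ISW: `173`; three values excluded by integrality with `a = 6`:
`64356 > 64196`, `63984 > 63894`, `63612 > 63594` at `N = 173, 172, 171`).  The gain over ISW grows like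
`n·‖√n‖²`: additive, never in the exponent. [elementary] -/
theorem srs_card_le_of_order_eq_thirtyone (h31 : ProjectivePlane.order P L = 31) (S : Finset (P × L))
    (hS : ∀ f ∈ S, ∀ g ∈ S, (f.1 ∈ g.2 ↔ f = g)) : S.card ≤ 170 := by
  have hisw := srs_card_sub_one_sq_le S hS
  have hint := srs_integrality S hS 6
  rw [h31] at hisw hint
  have h173 : S.card ≤ 173 := le_of_sub_one_sq_le hisw (by norm_num)
  by_contra hlt
  have h : S.card = 171 ∨ S.card = 172 ∨ S.card = 173 := by omega
  rcases h with h | h | h <;> rw [h] at hint <;> norm_num at hint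

open scoped Classical in
/-- **Order 3: an extremal system (`|S| = 6`, the ISW maximum) is of type `(1, 2, 3)`** — every
non-designated line meets its point set in `2` or `3` points (integrality is tight with `a = 2`:
`2·2·6·3 = 72 = 6·5 + 6·7`).  `SRS(3) = 6` is attained in `PG(2,3)` (siege census). [elementary] -/
theorem srs_type_of_order_eq_three (h3 : ProjectivePlane.order P L = 3) (S : Finset (P × L))
    (hS : ∀ f ∈ S, ∀ g ∈ S, (f.1 ∈ g.2 ↔ f = g)) (h6 : S.card = 6) :
    ∀ ℓ : L, ℓ ∉ S.image Prod.snd →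
      (S.filter fun f => f.1 ∈ ℓ).card = 2 ∨ (S.filter fun f => f.1 ∈ ℓ).card = 3 := by
  refine srs_integrality_eq S hS 2 ?_
  norm_num [h3, h6]

open scoped Classical in
/-- **Order 5: an extremal system (`|S| = 12`, the ISW maximum) is of type `(1, 3, 4)`** (integrality
tight with `a = 3`: `2·3·12·5 = 360 = 12·11 + 12·19`).  `SRS(5) = 12` is attained in `PG(2,5)`.
[elementary] -/
theorem srs_type_of_order_eq_five (h5 : ProjectivePlane.order P L = 5) (S : Finset (P × L))
    (hS : ∀ f ∈ S, ∀ g ∈ S, (f.1 ∈ g.2 ↔ f = g)) (h12 : S.card = 12) :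
    ∀ ℓ : L, ℓ ∉ S.image Prod.snd →
      (S.filter fun f => f.1 ∈ ℓ).card = 3 ∨ (S.filter fun f => f.1 ∈ ℓ).card = 4 := by
  refine srs_integrality_eq S hS 3 ?_
  norm_num [h5, h12]

open scoped Classical in
/-- **Order 7: an extremal system (`|S| = 19 = ⌊7√7 + 1⌋`) is of type `(1, 3, 4)`** (integrality tight
with `a = 3`: `2·3·19·7 = 798 = 19·18 + 12·38`): exactly the type of the cyclic semioval of `PG(2,7)`
(a Singer orbit of length `19`; Kiss 2008, p. 20), which attains it. [elementary] -/
theorem srs_type_of_order_eq_seven (h7 : ProjectivePlane.order P L = 7) (S : Finset (P × L))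
    (hS : ∀ f ∈ S, ∀ g ∈ S, (f.1 ∈ g.2 ↔ f = g)) (h19 : S.card = 19) :
    ∀ ℓ : L, ℓ ∉ S.image Prod.snd →
      (S.filter fun f => f.1 ∈ ℓ).card = 3 ∨ (S.filter fun f => f.1 ∈ ℓ).card = 4 := by
  refine srs_integrality_eq S hS 3 ?_
  norm_num [h7, h19]

end Summit.MatrixMultiplication.MatrixMultiplication.Theorems.LevelOneGL2Designs.PlaneUnital
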